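import Literature.NumberTheory.Weil1965.SiegelWeilNarrowRayBoundDominated
import Literature.NumberTheory.Weil1965.AdelicGaussTransformMajorant
import Literature.NumberTheory.Automorphic.AdelicAffineTwistHeightSum
import Literature.NumberTheory.Automorphic.MirabolicEisensteinResidue
import Summits.HodgeConjecture.HodgeConjecture.Theorems.H413E2SWBorelBound
import HarnessLib

/-!
# Crux H413, E-2 child line `F0_E2SiegelWeilWeilRange`, row SW2c-BOUND: the narrow-ray bound on a DOMINATED compact family,
# with the analytic letters (E1), (E3′), (T) DISCHARGED — the (NARROW) conjunct of `H413E2SWBorelBound.exists_borelBound_of_lemma20`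

HC_CM is proved only modulo the printed citations until rung 0 closes; nothing in this file is about HC.  Cell `hodgecm-mathlib`,
floor 0, programme P4, engine E-2, item stmt-HodgeConjecture-24833 (`--supports`); seat F0P4-p07 (g3); sheet `F0/P4/SW2c-BOUND-ASSEMBLY`
(v1, Lemme-20 route).  Companion of `Theorems/H413E2SWBorelBound.lean`: there the Borel bound (**)′ is reduced (Weil's Lemme 20) to the
hypothesis (DOM-C)+(NARROW) — for every compact `C` of the `W□`-member, a narrow-ray bound
`‖E(twist(z(ρ)⁻¹) Φ_k)‖ ≤ M_B · ρ^{m[F:ℚ]/2}` (`ρ ≤ 1`) UNIFORM over the implementer family `Φ_k = ω(q_k)Φ`, `k ∈ C`.  Here that bound is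
PROVED for any family `{Φ_k : k ∈ C}` DOMINATED pointwise by one Schwartz–Bruhat function `Φ₀` (Weil's Lemme 5, the (DOM-C) letter of
B-p12), from the STRUCTURE of the functional `E` alone:
* `E` splits as `‖EΦ‖ ≤ ‖E_I Φ‖ + κ‖E_E Φ‖` into a theta-type part controlled by tail sums over non-zero rational vectors through a compact
  family of frames `L_h` (the doubled theta integral: letter (Î) of B-p10) and an Eisenstein-type part controlled Fourier-side by
  `Σ_ξ |F*_Φ(ξ)|`, `F*_Φ(η) = ∫ chirp(η • S_h) Φ`, and MONOTONE under pointwise domination (the positive measure `E_X`: letter (E_X) of B-p02);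
* everything else is ★ and discharged here BY NAME: the decay data of `Φ₀` (★ `exists_decay_of_mem_piSchwartzBruhat`), the adelic Gauss
  majorant (E1) for `Φ₀` (★ `Weil1965.exists_norm_integral_chirp_smul_ratMatrix_le_vecHeight`, A-p08 (g17): `|F*_{Φ₀}(η)| ≤ A·h(1,η)^{−m/2}`),
  the sharp count (E3′) at `β = 0` (★ `Automorphic.exists_forall_pow_mul_tsum_vecHeight_affineTwist_rpow_neg_le`, B-p04 (g23): needs
  `m/2 > 2`), and Weil's narrow-ray estimate for dominated families (★ `Weil1964.exists_narrowRay_bound_of_dominated`, B-p12 (g19) over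
  F0P4-p07 (g2)'s `exists_narrowRay_bound`), at the base twist `a = 1` and chirp `β = 0`.
So the consumer of (**)′ owes only: the (Î)/(E_X) structure of the pen's `E''` and the pointwise domination of `{ω(q_k)Φ : k ∈ C}`.

References: A. Weil, *Sur la formule de Siegel dans la théorie des groupes classiques*, Acta Math. 113 (1965), n° 48 Lemmes 21–23,
n° 50 (proof of Thm. 4) [Weil1965]; A. Weil, *Sur certains groupes d'opérateurs unitaires*, Acta Math. 111 (1964), Chap. III n° 41
Lemme 5 [Weil1964].
-/

set_option autoImplicit false

noncomputable section

set_option linter.dupNamespace false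

namespace Summit.HodgeConjecture.HodgeConjecture.Cruxes.H413.E2SWBorelBoundNarrowC

open scoped NNReal ENNReal Matrix
open _root_.MeasureTheory NumberField IsDedekindDomain Matrix
open Literature.RepresentationTheory.HeisenbergGroup
open Literature.NumberTheory.Weil1964 Literature.NumberTheory.Weil1965 Literature.NumberTheory.Automorphic
open Literature.NumberTheory.Automorphic.DoubledUnitary.RankOneReduction

variable (F : Type) [Field F] [NumberField F]

/-- The good-set coordinates `β = 0`, `a = 1`: `chirp(0 • S) ∘ twist(1 · g) = twist(g)` on `𝒮(𝔸_F^m)`. [folklore] -/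
theorem chirpLM_zero_smul_twistLM_one_mul {m : ℕ} (S : Matrix (Fin m) (Fin m) (AdeleRing (𝓞 F) F))
    (g : GL (Fin m) (AdeleRing (𝓞 F) F)) (Ψ : piSchwartzBruhat F (Fin m)) :
    chirpLM F ((0 : AdeleRing (𝓞 F) F) • S) (twistLM F (1 * g) Ψ) = twistLM F g Ψ := by
  rw [zero_smul, chirpLM_zero, one_mul, Module.End.one_apply]

/-- **THE NARROW-RAY BOUND ON A DOMINATED COMPACT FAMILY, analytic letters discharged.**  For a totally real `F`, a rational symmetric
non-degenerate `S_h ∈ Sym_m(F)` (`m > 4`), a functional `E` on `𝒮(𝔸_F^m)` with the (Î)/(E_X) structure (`hsplit`, `hI` through frames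
`L_h`, `h ∈ Ω`, with finite parts in a compact set and bounded archimedean height, `hEE`, `hEEmono`), and ANY family `Φ_k`, `k ∈ C`,
dominated pointwise by one `Φ₀ ∈ 𝒮(𝔸_F^m)`: `∃ M_B < ∞, ∀ ρ ≤ 1, ∀ k ∈ C, ‖E(twist(z(ρ)⁻¹) Φ_k)‖ ≤ M_B · ρ^{m[F:ℚ]/2}` — the (NARROW)
conjunct of `H413E2SWBorelBound.exists_borelBound_of_lemma20` (with `Φ_k := ω(q_k)Φ`). [cite: Weil1965, n° 48 Lemmes 21–23 and n° 50]
[cite: Weil1964, Chap. III n° 41 Lemme 5 p. 194] -/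
theorem narrow_of_dominated [IsTotallyReal F] {m : ℕ}
    [MeasurableSpace (AdeleRing (𝓞 F) F)] [BorelSpace (AdeleRing (𝓞 F) F)]
    (ν : Measure (Fin m → AdeleRing (𝓞 F) F)) [ν.IsAddHaarMeasure]
    {Sr : Matrix (Fin m) (Fin m) F} (hSr : Sr.IsSymm) (hSrdet : Sr.det ≠ 0)
    (E EI EE : piSchwartzBruhat F (Fin m) →ₗ[ℂ] ℂ) (κ : ℝ≥0∞) (hκ : κ ≠ ⊤)
    (hsplit : ∀ Φ : piSchwartzBruhat F (Fin m), (‖E Φ‖ₑ : ℝ≥0∞) ≤ ‖EI Φ‖ₑ + κ * ‖EE Φ‖ₑ)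
    -- theta-type part (Î)
    {ι : Type*} (Ω : Set ι) (L : ι → GL (Fin m) (AdeleRing (𝓞 F) F)) (cI : ℝ≥0∞) (hcI : cI ≠ ⊤)
    (hI : ∀ (Φ : piSchwartzBruhat F (Fin m)) (B : ℝ≥0∞),
      (∀ h ∈ Ω, ∑' v : ↥{v : Fin m → F | v ≠ 0},
        (‖(Φ : (Fin m → AdeleRing (𝓞 F) F) → ℂ) (ratVec F (v : Fin m → F) ᵥ*
          (L h : Matrix (Fin m) (Fin m) (AdeleRing (𝓞 F) F)))‖ₑ : ℝ≥0∞) ≤ B) → (‖EI Φ‖ₑ : ℝ≥0∞) ≤ cI * B)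
    {𝒴 : Set (GL (Fin m) (FiniteAdeleRing (𝓞 F) F))} (h𝒴 : IsCompact 𝒴) {H₀ : ℝ}
    (hL : ∀ h ∈ Ω, GLn.sndHom m F (L h) ∈ 𝒴 ∧ (GLn.archHeight m F (L h) : ℝ) ≤ H₀)
    -- Eisenstein-type part (E_X), Fourier side, and its monotonicity
    (hEE : ∀ Φ : piSchwartzBruhat F (Fin m), (‖EE Φ‖ₑ : ℝ≥0∞) ≤
      ∑' ξ : F, (‖∫ x, chirp F ((algebraMap F (AdeleRing (𝓞 F) F) ξ) • ratMatrix F Sr)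
        ((Φ : piSchwartzBruhat F (Fin m)) : (Fin m → AdeleRing (𝓞 F) F) → ℂ) x ∂ν‖ₑ : ℝ≥0∞))
    (hEEmono : ∀ Φ Ψ : piSchwartzBruhat F (Fin m),
      (∀ x, ‖(Φ : (Fin m → AdeleRing (𝓞 F) F) → ℂ) x‖ ≤ ((Ψ : (Fin m → AdeleRing (𝓞 F) F) → ℂ) x).re) →
        (‖EE Φ‖ₑ : ℝ≥0∞) ≤ ‖EE Ψ‖ₑ)
    (hm : 4 < m)
    -- the dominated family
    {X : Type*} (C : Set X) (f : X → piSchwartzBruhat F (Fin m)) (Φ₀ : piSchwartzBruhat F (Fin m))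
    (hdom : ∀ k ∈ C, ∀ x, ‖((f k : piSchwartzBruhat F (Fin m)) : (Fin m → AdeleRing (𝓞 F) F) → ℂ) x‖ ≤
      (((Φ₀ : piSchwartzBruhat F (Fin m)) : (Fin m → AdeleRing (𝓞 F) F) → ℂ) x).re) :
    ∃ MB : ℝ≥0∞, MB ≠ ⊤ ∧ ∀ ρ : ℝ≥0ˣ, (ρ : ℝ≥0) ≤ 1 → ∀ k ∈ C,
      (‖E (twistLM F (posRealScalar m F ρ)⁻¹ (f k))‖ₑ : ℝ≥0∞) ≤
        MB * ENNReal.ofReal (((ρ : ℝ≥0) : ℝ) ^ ((m : ℝ) * Module.finrank ℚ F / 2)) := by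
  classical
  -- decay data of `Φ₀` of order `k₀ > m [F:ℚ]` (★ `exists_decay_of_mem_piSchwartzBruhat`)
  have hdata := exists_decay_of_mem_piSchwartzBruhat (K := F) Φ₀.2 (m * Module.finrank ℚ F + 1)
  obtain ⟨M, hM0, Cf, hCfc, hdecay, hCf⟩ := hdata
  have hk : (m : ℝ) * Module.finrank ℚ F < ((m * Module.finrank ℚ F + 1 : ℕ) : ℝ) := by
    push_cast
    linarith
  -- (E1) for `Φ₀` (★ A-p08 (g17))
  have hE1' := exists_norm_integral_chirp_smul_ratMatrix_le_vecHeight F ν hSr hSrdet Φ₀.2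
  obtain ⟨A₁, hA₁, hE1⟩ := hE1'
  -- (E3′) at `β = 0`, `u = 1` (★ B-p04 (g23)); exponent `N = m/2 > 2`
  have hN : (2 : ℝ) < (m : ℝ) / 2 := by
    have hm' : (4 : ℝ) < m := by exact_mod_cast hm
    linarith
  have hE3' := exists_forall_pow_mul_tsum_vecHeight_affineTwist_rpow_neg_le F hN
    (isCompact_singleton (x := (0 : AdeleRing (𝓞 F) F))) (isCompact_singleton (x := (1 : (AdeleRing (𝓞 F) F)ˣ)))
  obtain ⟨C3, hC3⟩ := hE3'
  have hE3 : ∀ a ∈ ({1} : Set (GL (Fin m) (AdeleRing (𝓞 F) F))), ∀ s : ℝ≥0ˣ, (s : ℝ≥0) ≤ 1 →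
      ENNReal.ofReal (((s : ℝ≥0) : ℝ) ^ Module.finrank ℚ F) *
        ∑' ξ : F, ENNReal.ofReal (((vecHeight F (![1, algebraMap F (AdeleRing (𝓞 F) F) ξ * (fun _ => (1 : AdeleRing (𝓞 F) F)) a *
          ((posRealIdele F s : (AdeleRing (𝓞 F) F)ˣ) : AdeleRing (𝓞 F) F)] : Fin 2 → AdeleRing (𝓞 F) F) : ℝ≥0) : ℝ) ^
            (-((m : ℝ) / 2))) ≤ ENNReal.ofReal (max C3 0) := by
    intro a _ s hs
    have hs' : ((s : ℝ≥0) : ℝ) ≤ 1 := by exact_mod_cast hs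
    have h3 := hC3 0 (Set.mem_singleton _) 1 (Set.mem_singleton _) s hs'
    obtain ⟨hsum, hle⟩ := h3
    simp only [add_zero, Units.val_one, mul_one] at hsum hle ⊢
    rw [← ENNReal.ofReal_tsum_of_nonneg (fun ξ => Real.rpow_nonneg (NNReal.coe_nonneg _) _) hsum,
      ← ENNReal.ofReal_mul (by positivity)]
    exact ENNReal.ofReal_le_ofReal (hle.trans (le_max_left _ _))
  -- the base twist `a = 1`: similitude factor `1`, frames unchanged, `|det|⁻¹ = 1`
  have hsim : ∀ a ∈ ({1} : Set (GL (Fin m) (AdeleRing (𝓞 F) F))),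
      ((a⁻¹ : GL (Fin m) (AdeleRing (𝓞 F) F)) : Matrix (Fin m) (Fin m) (AdeleRing (𝓞 F) F)) * ratMatrix F Sr *
        (((a⁻¹ : GL (Fin m) (AdeleRing (𝓞 F) F)) : Matrix (Fin m) (Fin m) (AdeleRing (𝓞 F) F)))ᵀ =
      (fun _ => (1 : AdeleRing (𝓞 F) F)) a • ratMatrix F Sr := by
    intro a ha
    rw [Set.mem_singleton_iff.1 ha, inv_one, Units.val_one, Matrix.transpose_one, Matrix.one_mul, Matrix.mul_one, one_smul]
  have hLA : ∀ h ∈ Ω, ∀ a ∈ ({1} : Set (GL (Fin m) (AdeleRing (𝓞 F) F))),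
      GLn.sndHom m F (L h * a) ∈ 𝒴 ∧ (GLn.archHeight m F (L h * a) : ℝ) ≤ H₀ := by
    intro h hh a ha
    rw [Set.mem_singleton_iff.1 ha, mul_one]
    exact hL h hh
  have hdet : ∀ a ∈ ({1} : Set (GL (Fin m) (AdeleRing (𝓞 F) F))), (adelicAbsDet m F a)⁻¹ ≤ (1 : ℝ≥0) := by
    intro a ha
    rw [Set.mem_singleton_iff.1 ha, map_one, inv_one]
  -- Weil's narrow-ray estimate for the dominated family (★ B-p12 (g19))
  have key := exists_narrowRay_bound_of_dominated F ν (ratMatrix F Sr) E EI EE κ hκ hsplit Ω L cI hcI hI hEE hEEmono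
    (f '' C) Φ₀ (by
      rintro _ ⟨k, hk, rfl⟩
      exact hdom k hk) hM0 hdecay hCfc hCf hA₁ hE1
    ({1} : Set (GL (Fin m) (AdeleRing (𝓞 F) F))) (fun _ => (1 : AdeleRing (𝓞 F) F)) hsim h𝒴 hLA hdet
    (ENNReal.ofReal (max C3 0)) ENNReal.ofReal_ne_top hE3 hm.le hk
  obtain ⟨MB, hMB, hB⟩ := key
  refine ⟨MB, hMB, fun ρ hρ k hk => ?_⟩
  have h := hB 0 1 (Set.mem_singleton _) ρ hρ (f k) ⟨k, hk, rfl⟩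
  rw [chirpLM_zero_smul_twistLM_one_mul] at h
  exact h

/-- **(**)′ ON THE WHOLE BOREL FROM LEMME 20 + LEMME 5: the dominated form.**  `H413E2SWBorelBound.exists_borelBound_of_lemma20` with its
(NARROW) conjunct DISCHARGED by `narrow_of_dominated`: the inputs are now (INV) isometric `E''`-invariant lifts of the rational points, (RAY) the
real-ray lift acting by dilation, (IMPL)+(DOM-C) implementers of every compact `C ⊆ U_D` with moduli `≥ c₁ > 0` whose translates `ω(q_k)Φ` are
dominated by ONE Schwartz–Bruhat function, and the (Î)/(E_X) structure of `E''`; everything analytic is ★ and consumed by name.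
[cite: Weil1965, n° 47 Lemme 20, n° 48 Lemmes 21–23, n° 50] [cite: Weil1964, Chap. III n° 41 Lemme 5 p. 194] -/
theorem exists_borelBound_of_lemma20_of_dominated [IsTotallyReal F]
    (E : Type) [Field E] [NumberField E] [Algebra F E] (c : E ≃ₐ[F] E) (TW : Matrix (Fin 1) (Fin 1) F)
    [IsGalois F E] (h2 : ∀ σ : E ≃ₐ[F] E, σ = 1 ∨ σ = c) (δ : Eˣ) (hcδ : c (δ : E) = -(δ : E)) (hTW : TW 0 0 ≠ 0)
    {m : ℕ} (T : Matrix (Fin m) (Fin m) (AdeleRing (𝓞 F) F)) (hT : IsUnit T.det)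
    [MeasurableSpace (AdeleRing (𝓞 F) F)] [BorelSpace (AdeleRing (𝓞 F) F)]
    (ν : Measure (Fin m → AdeleRing (𝓞 F) F)) [ν.IsAddHaarMeasure]
    (E'' : piSchwartzBruhat F (Fin m) →ₗ[ℂ] ℂ) (Φ : piSchwartzBruhat F (Fin m))
    (j : ↥(UnitaryGroup.adelic F E c (1 + 1)
        ((Matrix.reindex finSumFinEquiv finSumFinEquiv (Matrix.fromBlocks TW 0 0 (-TW))).map (algebraMap F E))) →*
      ↥(symplecticGroup (polar (adelicForm F (Fin m) T))))
    -- (INV)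
    (hINV : ∀ (γ : GL (Fin (1 + 1)) (AdeleRing (𝓞 E) E))
      (hγ : γ ∈ UnitaryGroup.adelic F E c (1 + 1)
        ((Matrix.reindex finSumFinEquiv finSumFinEquiv (Matrix.fromBlocks TW 0 0 (-TW))).map (algebraMap F E))),
      γ ∈ (Matrix.GeneralLinearGroup.map (algebraMap E (AdeleRing (𝓞 E) E))).range →
      ∃ r : adelicMpCont F (Fin m) T, adelicMpCont.proj F (Fin m) T r = j ⟨γ, hγ⟩ ∧
        adelicMpCont.l2Scaling F T hT ν r = 1 ∧ E'' ∘ₗ adelicMpCont.omega F (Fin m) T r⁻¹ = E'')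
    -- (RAY)
    (hRAY : ∀ (M : GL (Fin 2) (AdeleRing (𝓞 E) E))
      (hM : (M : Matrix (Fin 2) (Fin 2) (AdeleRing (𝓞 E) E)) =
        !![1, algebraMap E (AdeleRing (𝓞 E) E) (algebraMap F E (2 * TW 0 0)⁻¹);
          1, -algebraMap E (AdeleRing (𝓞 E) E) (algebraMap F E (2 * TW 0 0)⁻¹)])
      (r : ℝ≥0ˣ), 1 ≤ (r : ℝ≥0) →
      ∃ g : adelicMpCont F (Fin m) T,
        adelicMpCont.proj F (Fin m) T g =
          j ⟨M * glDiagonal 2 (AdeleRing (𝓞 E) E) ![posRealIdele E r, (posRealIdele E r)⁻¹] * M⁻¹,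
            cayley_conj_diag_posRealIdele_mem_adelic F E c TW hTW hM r⟩ ∧
        ∀ Ψ : piSchwartzBruhat F (Fin m), adelicMpCont.omega F (Fin m) T g Ψ = twistLM F (posRealScalar m F r) Ψ)
    -- (IMPL) + (DOM-C): implementers of every compact `C ⊆ U_D` with moduli `≥ c₁ > 0`, and ONE dominating Schwartz–Bruhat function
    (hIMPL : ∀ C : Set (GL (Fin (1 + 1)) (AdeleRing (𝓞 E) E)), IsCompact C →
      ∀ hCU : C ⊆ UnitaryGroup.adelic F E c (1 + 1)
        ((Matrix.reindex finSumFinEquiv finSumFinEquiv (Matrix.fromBlocks TW 0 0 (-TW))).map (algebraMap F E)),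
      ∃ q : GL (Fin (1 + 1)) (AdeleRing (𝓞 E) E) → adelicMpCont F (Fin m) T,
        (∀ (k : GL (Fin (1 + 1)) (AdeleRing (𝓞 E) E)) (hk : k ∈ C), adelicMpCont.proj F (Fin m) T (q k) = j ⟨k, hCU hk⟩) ∧
        (∃ c₁ : ℝ, 0 < c₁ ∧ ∀ k ∈ C, c₁ ≤ (adelicMpCont.l2Scaling F T hT ν (q k)).toReal) ∧
        ∃ Φ₀ : piSchwartzBruhat F (Fin m), ∀ k ∈ C, ∀ x,
          ‖((adelicMpCont.omega F (Fin m) T (q k) Φ : piSchwartzBruhat F (Fin m)) : (Fin m → AdeleRing (𝓞 F) F) → ℂ) x‖ ≤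
            (((Φ₀ : piSchwartzBruhat F (Fin m)) : (Fin m → AdeleRing (𝓞 F) F) → ℂ) x).re)
    -- the (Î)/(E_X) structure of `E''`
    {Sr : Matrix (Fin m) (Fin m) F} (hSr : Sr.IsSymm) (hSrdet : Sr.det ≠ 0)
    (EI EE : piSchwartzBruhat F (Fin m) →ₗ[ℂ] ℂ) (κ : ℝ≥0∞) (hκ : κ ≠ ⊤)
    (hsplit : ∀ Ψ : piSchwartzBruhat F (Fin m), (‖E'' Ψ‖ₑ : ℝ≥0∞) ≤ ‖EI Ψ‖ₑ + κ * ‖EE Ψ‖ₑ)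
    {ι : Type*} (Ω : Set ι) (L : ι → GL (Fin m) (AdeleRing (𝓞 F) F)) (cI : ℝ≥0∞) (hcI : cI ≠ ⊤)
    (hI : ∀ (Ψ : piSchwartzBruhat F (Fin m)) (B : ℝ≥0∞),
      (∀ h ∈ Ω, ∑' v : ↥{v : Fin m → F | v ≠ 0},
        (‖(Ψ : (Fin m → AdeleRing (𝓞 F) F) → ℂ) (ratVec F (v : Fin m → F) ᵥ*
          (L h : Matrix (Fin m) (Fin m) (AdeleRing (𝓞 F) F)))‖ₑ : ℝ≥0∞) ≤ B) → (‖EI Ψ‖ₑ : ℝ≥0∞) ≤ cI * B)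
    {𝒴 : Set (GL (Fin m) (FiniteAdeleRing (𝓞 F) F))} (h𝒴 : IsCompact 𝒴) {H₀ : ℝ}
    (hL : ∀ h ∈ Ω, GLn.sndHom m F (L h) ∈ 𝒴 ∧ (GLn.archHeight m F (L h) : ℝ) ≤ H₀)
    (hEE : ∀ Ψ : piSchwartzBruhat F (Fin m), (‖EE Ψ‖ₑ : ℝ≥0∞) ≤
      ∑' ξ : F, (‖∫ x, chirp F ((algebraMap F (AdeleRing (𝓞 F) F) ξ) • ratMatrix F Sr)
        ((Ψ : piSchwartzBruhat F (Fin m)) : (Fin m → AdeleRing (𝓞 F) F) → ℂ) x ∂ν‖ₑ : ℝ≥0∞))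
    (hEEmono : ∀ Ψ Ψ' : piSchwartzBruhat F (Fin m),
      (∀ x, ‖(Ψ : (Fin m → AdeleRing (𝓞 F) F) → ℂ) x‖ ≤ ((Ψ' : (Fin m → AdeleRing (𝓞 F) F) → ℂ) x).re) →
        (‖EE Ψ‖ₑ : ℝ≥0∞) ≤ ‖EE Ψ'‖ₑ)
    (hm : 4 < m) :
    ∃ Mbound : ℝ, ∀ (p : adelicMpCont F (Fin m) T) (b : GL (Fin (1 + 1)) (AdeleRing (𝓞 E) E))
      (hb : b ∈ UnitaryGroup.adelic F E c (1 + 1)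
        ((Matrix.reindex finSumFinEquiv finSumFinEquiv (Matrix.fromBlocks TW 0 0 (-TW))).map (algebraMap F E))),
      (b : Matrix (Fin (1 + 1)) (Fin (1 + 1)) (AdeleRing (𝓞 E) E)) 0 0 + (b : Matrix (Fin (1 + 1)) (Fin (1 + 1)) (AdeleRing (𝓞 E) E)) 0 1 =
        (b : Matrix (Fin (1 + 1)) (Fin (1 + 1)) (AdeleRing (𝓞 E) E)) 1 0 + (b : Matrix (Fin (1 + 1)) (Fin (1 + 1)) (AdeleRing (𝓞 E) E)) 1 1 →
      adelicMpCont.proj F (Fin m) T p = j ⟨b, hb⟩ →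
      ‖E'' (adelicMpCont.omega F (Fin m) T p Φ)‖ ≤ Mbound * Real.sqrt (adelicMpCont.l2Scaling F T hT ν p).toReal := by
  refine E2SWBorelBound.exists_borelBound_of_lemma20 F E c TW h2 δ hcδ hTW T hT ν E'' Φ j hINV hRAY ?_
  intro C hCc hCU
  have h1 := hIMPL C hCc hCU
  obtain ⟨q, hq, hc₁, hΦ₀⟩ := h1
  obtain ⟨Φ₀, hdom⟩ := hΦ₀
  have h2 := narrow_of_dominated F ν hSr hSrdet E'' EI EE κ hκ hsplit Ω L cI hcI hI h𝒴 hL hEE hEEmono hm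
    C (fun k => adelicMpCont.omega F (Fin m) T (q k) Φ) Φ₀ hdom
  exact ⟨q, hq, hc₁, h2⟩

end Summit.HodgeConjecture.HodgeConjecture.Cruxes.H413.E2SWBorelBoundNarrowC

end
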